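import Summits.CriticalPhenomena.CardyFormulaZ2.Theorems.CardyComplexConeEdgePrecompactUFRSMixedSectors
import Literature.Probability.Percolation.LatticeTraceGeometry

/-!
# The probe below a fake touchdown meets another strand
(line `qkz-strip-boundary-arm` of crux `CardyComplexCone.EdgePrecompact`, stmt-CriticalPhenomena-11387;
the coincidence step of the corrected three-strands dichotomy for MIXED tags — worker W-HT5 of
lead c5, wave 5)

In the sector picture of `strands_sectorsZ_chains_HT5` (`…UFRSMixedSectorsChains.lean`) let `v` be a
chain vertex of a strand whose left sector `C` is interior (misses the exterior set `Z`), and let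
the lattice column (or row) segment `[v, v + h·dir]` lie in the annulus with its far end in `Z`
(this is the situation of a FAKE TOUCHDOWN of a strand of the inner completion on its wired row,
`h` rows above the wired row of the outer completion). Since `C` absorbs every preconnected
piece-free subset of the annulus that it meets, the segment must meet a piece of some strand; a
lattice point is never on a piece, an in-face dart piece never meets an edge trace
(`cyDart_disjoint_edgeTrace`), so a CONNECTOR of some strand `a` meets the open trace of one of the
`h` unit edges of the segment, i.e. (`conn_meets_edge_HT4`) strand `a` CROSSES that edge at some
index `m < j a`: `cTgt (O_a m) = {v + i₀ dir, v + (i₀+1) dir} ∉ β a`. This is the strand "below the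
touchdown" that feeds the four half-strand sector run at the coincidence point
(`probe_meets_strand_HT5`, registered anchor `ufrs_probeMeetsStrand`).

References: M. Aizenman, A. Burchard, Duke Math. J. 99 (1999), App. A; S. Smirnov, C. R. Acad.
Sci. Paris 333 (2001), §2.
(buildfix 2026-08-20: comment-only re-land to re-enqueue the module build after its blocking imports were repaired; no declaration changed.)
-/

namespace Summit.CriticalPhenomena.CardyFormulaZ2.Cruxes.EdgePrecompact.QkzStripBoundaryArm

open MeasureTheory Filter Set Metric Complex
open scoped Topology BigOperators Pointwise
open Literature.Probability.LatticeModels Literature.Probability.Percolation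
open Literature.Probability.RandomPlanarGeometry (DobrushinDomain)
open Summit.CriticalPhenomena.CardyFormulaZ2.Theses.CardyComplexCone
open Literature.Topology.PlaneTopology

noncomputable section

/-- `Site.toComplex` of a lattice multiple. -/
theorem toComplex_add_nsmul_HT5 (v dir : Site 2) (n : ℕ) :
    Site.toComplex (v + n • dir) = Site.toComplex v + (n : ℂ) * Site.toComplex dir := by
  apply Complex.ext <;> simp [Site.toComplex, nsmul_eq_mul]

/-- **A point of the lattice segment `[v, v + h·dir]` lies on one of its `h` unit sub-segments.** -/
theorem mem_subsegment_HT5 (v dir : Site 2) {h : ℕ} (hh : 1 ≤ h) {w : ℂ}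
    (hw : w ∈ segment ℝ (Site.toComplex v) (Site.toComplex (v + h • dir))) :
    ∃ i₀, i₀ < h ∧ w ∈ segment ℝ (Site.toComplex (v + i₀ • dir)) (Site.toComplex (v + (i₀ + 1) • dir)) := by
  rw [segment_eq_image'] at hw
  obtain ⟨θ, ⟨hθ0, hθ1⟩, rfl⟩ := hw
  set D : ℂ := Site.toComplex dir with hD
  set v' : ℂ := Site.toComplex v with hv'
  have hend : Site.toComplex (v + h • dir) = v' + (h : ℂ) * D := toComplex_add_nsmul_HT5 v dir h
  set x : ℝ := θ * h with hx
  have hx0 : 0 ≤ x := by positivity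
  have hxh : x ≤ h := by
    have : θ * (h : ℝ) ≤ 1 * h := mul_le_mul_of_nonneg_right hθ1 (by positivity)
    simpa [hx] using this
  set i₀ : ℕ := min ⌊x⌋₊ (h - 1) with hi₀
  have hi₀h : i₀ < h := by have := min_le_right ⌊x⌋₊ (h - 1); omega
  have hlo : (i₀ : ℝ) ≤ x := by
    have h1 : (i₀ : ℝ) ≤ ⌊x⌋₊ := by exact_mod_cast min_le_left _ _
    exact h1.trans (Nat.floor_le hx0)
  have hhi : x ≤ i₀ + 1 := by
    rcases le_total ⌊x⌋₊ (h - 1) with h1 | h1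
    · have : i₀ = ⌊x⌋₊ := by rw [hi₀]; exact min_eq_left h1
      rw [this]; exact (Nat.lt_floor_add_one x).le
    · have : i₀ = h - 1 := by rw [hi₀]; exact min_eq_right h1
      rw [this]; push_cast [hh]; linarith
  refine ⟨i₀, hi₀h, ?_⟩
  rw [toComplex_add_nsmul_HT5, toComplex_add_nsmul_HT5]
  refine ⟨1 - (x - i₀), x - i₀, by linarith, by linarith, by ring, ?_⟩
  rw [hend]
  have : (θ : ℂ) * (h : ℂ) = (x : ℂ) := by rw [hx]; push_cast; ring
  simp only [Complex.real_smul]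
  push_cast
  linear_combination (-D) * this

/-- **The probe below a fake touchdown meets another strand** (see the module docstring):
`C` absorbs preconnected piece-free subsets of `U` meeting it, the lattice segment
`[v, v + h·dir]` lies in `U`, starts in `C` and ends outside `C`; then some strand crosses one of the
`h` unit edges of the segment. -/
theorem probe_meets_strand_HT5 {k : ℕ} (β : Fin k → BondConfig (Site 2)) (c : Fin k → Site 2 × Fin 4) (i j : Fin k → ℕ)
    (C U : Set ℂ)
    (habs : ∀ S : Set ℂ, IsPreconnected S → S ⊆ U →
      (∀ w ∈ S, ∀ a jj, jj ≤ 2 * (j a - i a) →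
        w ∉ segment ℝ (pieceVert (β a) (cornerOrbit (β a) (c a) (i a)) jj) (pieceVert (β a) (cornerOrbit (β a) (c a) (i a)) (jj + 1))) →
      (S ∩ C).Nonempty → S ⊆ C)
    (v dir : Site 2) (hadj : ∀ u : Site 2, (zdGraph 2).Adj u (u + dir)) (h : ℕ)
    (hU : segment ℝ (Site.toComplex v) (Site.toComplex (v + h • dir)) ⊆ U)
    (hv : Site.toComplex v ∈ C) (hfar : Site.toComplex (v + h • dir) ∉ C) :
    ∃ a m i₀, i a ≤ m ∧ m < j a ∧ i₀ < h ∧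
      cTgt (cornerOrbit (β a) (c a) m) = s(v + i₀ • dir, v + (i₀ + 1) • dir) ∧ cTgt (cornerOrbit (β a) (c a) m) ∉ β a := by
  by_contra hne
  push Not at hne
  set S : Set ℂ := segment ℝ (Site.toComplex v) (Site.toComplex (v + h • dir)) with hS
  have hh : 1 ≤ h := by
    rcases Nat.eq_zero_or_pos h with rfl | hpos
    · exfalso; apply hfar; simpa using hv
    · exact hpos
  have hclean : ∀ w ∈ S, ∀ a jj, jj ≤ 2 * (j a - i a) →
      w ∉ segment ℝ (pieceVert (β a) (cornerOrbit (β a) (c a) (i a)) jj) (pieceVert (β a) (cornerOrbit (β a) (c a) (i a)) (jj + 1)) := by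
    intro w hw a jj hjj hwp
    obtain ⟨i₀, hi₀, hwi⟩ := mem_subsegment_HT5 v dir hh hw
    have hadj' : (zdGraph 2).Adj (v + i₀ • dir) (v + (i₀ + 1) • dir) := by
      have := hadj (v + i₀ • dir); rwa [add_smul, one_smul, ← add_assoc]
    have hzE : w ∈ edgeTrace s(v + i₀ • dir, v + (i₀ + 1) • dir) := by rw [edgeTrace_mk]; exact hwi
    set q := cornerOrbit (β a) (c a) (i a) with hq
    obtain ⟨m, rfl | rfl⟩ := Nat.even_or_odd' jj
    · rw [piece_even_eq_cyDart] at hwp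
      exact cyDart_disjoint_edgeTrace m hadj' hwp hzE
    · rw [piece_odd_eq_cyConn] at hwp
      obtain ⟨htgt, hclosed⟩ := conn_meets_edge_HT4 q m hadj' hwp hzE
      have horb : cornerOrbit (β a) q m = cornerOrbit (β a) (c a) (i a + m) := (cornerOrbit_add_eq (β a) (c a) (i a) m).symm
      rw [horb] at htgt hclosed
      exact hclosed (hne a (i a + m) i₀ (Nat.le_add_right _ _) (by omega) hi₀ htgt)
  have hsub : S ⊆ C := habs S (convex_segment _ _).isPreconnected hU hclean ⟨_, left_mem_segment ℝ _ _, hv⟩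
  exact hfar (hsub (right_mem_segment ℝ _ _))

/-- **The probe below a fake touchdown meets another strand** (registered anchor `ufrs_probeMeetsStrand`
of stmt-CriticalPhenomena-11387; `probe_meets_strand_HT5` with all binders explicit). -/
theorem ufrs_probeMeetsStrand : ∀ (k : ℕ) (β : Fin k → BondConfig (Site 2)) (c : Fin k → Site 2 × Fin 4) (i j : Fin k → ℕ) (C U : Set ℂ), (∀ S : Set ℂ, IsPreconnected S → S ⊆ U → (∀ w ∈ S, ∀ a jj, jj ≤ 2 * (j a - i a) → w ∉ segment ℝ (pieceVert (β a) (cornerOrbit (β a) (c a) (i a)) jj) (pieceVert (β a) (cornerOrbit (β a) (c a) (i a)) (jj + 1))) → (S ∩ C).Nonempty → S ⊆ C) → ∀ (v dir : Site 2), (∀ u : Site 2, (zdGraph 2).Adj u (u + dir)) → ∀ (h : ℕ), segment ℝ (Site.toComplex v) (Site.toComplex (v + h • dir)) ⊆ U → Site.toComplex v ∈ C → Site.toComplex (v + h • dir) ∉ C → ∃ a m i₀, i a ≤ m ∧ m < j a ∧ i₀ < h ∧ cTgt (cornerOrbit (β a) (c a) m) = s(v + i₀ • dir, v + (i₀ +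 1) • dir) ∧ cTgt (cornerOrbit (β a) (c a) m) ∉ β a :=
  fun _k β c i j C U habs v dir hadj h hU hv hfar => probe_meets_strand_HT5 β c i j C U habs v dir hadj h hU hv hfar

end

end Summit.CriticalPhenomena.CardyFormulaZ2.Cruxes.EdgePrecompact.QkzStripBoundaryArm
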